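import Summits.Ventures.DiscreteObjects.Hadamard.PrimeOrder167
import Summits.Ventures.DiscreteObjects.Hadamard.PrimeOrderSummary668B
import Summits.Ventures.DiscreteObjects.Hadamard.PrimeOrder13

/-!
# Hadamard 668 census, family F12 — the fixed structure of every prime-order automorphism of H(668) with p ≥ 13 (kernel summary)

Framing: lottery ticket; floor = certified bounds/negative ranges.

Cell pub-namedobj (venture DiscreteObjects), target (H), hadamard gen 9.  One quotable statement collecting the kernel theorems
of gens 5–9 on the FIXED ROWS/COLUMNS of a signed-permutation automorphism `(π, κ, d, e)` of prime order `p ≥ 13` of a Hadamard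
matrix of order `668` (`π^p = κ^p = 1`, `(π, κ) ≠ (1, 1)`):
* `hadamard668_fixedRows_13` (new here, transfer of `orbitStructure_13`): `p = 13` ⇒ exactly `44 + 44` fixed rows/columns
  (`48 + 48` orbits);
* `hadamard668_signedAut_fixedRows` (summary): `p ∈ {13, 23, 37, 41, 83, 167}` (`hadamard668_signedAut_prime_mem'`) and the number
  `f` of fixed rows equals the number of fixed columns with `(p, f) ∈ {(13, 44), (23, 1), (23, 24), (37, 2), (41, 12), (83, 4),
  (167, 0)}` (`hadamard668_fixedRows_23/37/41/83/167`).
So every automorphism of prime order `p ≥ 13` of an H(668) has one of seven orbit shapes; for `p ∈ {23 (f = 1), 37, 41, 83, 167}`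
explicit orbit matrices exist (`Z23OrbitMatrix`, `Z37OrbitMatrix`, `Z41OrbitMatrix` certificates; gens 5/7/9), for
`(23, 24)` and `13` the orbit-matrix level is open.  Ours, not literature; no `sorry`.
-/

open Finset BigOperators Matrix

namespace Summit.Ventures.DiscreteObjects.Hadamard

open Literature.Combinatorics.Designs.GoethalsSeidel (IsHadamardMatrix)

variable {ι : Type*} [Fintype ι] [DecidableEq ι]

/-- fixed row and column of a nontrivial signed automorphism of odd prime order `p ∤ 668`, with `π ≠ 1` -/
private lemma fixed_row_col_gen {H : Matrix ι ι ℤ} (hH : IsHadamardMatrix H) (hι : Fintype.card ι = 668) (p : ℕ)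
    (hp : p.Prime) (hpd : ¬ p ∣ 668) (hodd : Odd p)
    (π κ : Equiv.Perm ι) (d e : ι → ℤ) (haut : IsSignedAut H π κ d e)
    (hπ : π ^ p = 1) (hκ : κ ^ p = 1) (hne : π ≠ 1 ∨ κ ≠ 1) :
    π ≠ 1 ∧ (∃ r, π r = r) ∧ (∃ c, κ c = c) := by
  have hcard : (Fintype.card ι : ℤ) ≠ 0 := by rw [hι]; norm_num
  have hπ1 : π ≠ 1 := by
    rcases hne with h | h
    · exact h
    · intro hπ1
      apply h
      rw [hπ1] at haut
      exact signedAut_snd_eq_one H hH hcard haut hodd hκ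
  have hnd : ¬ p ∣ Fintype.card ι := by rw [hι]; exact hpd
  haveI : Fact p.Prime := ⟨hp⟩
  exact ⟨hπ1, Equiv.Perm.exists_fixed_point_of_prime (n := 1) hnd (σ := π) (by rw [pow_one]; exact hπ),
    Equiv.Perm.exists_fixed_point_of_prime (n := 1) hnd (σ := κ) (by rw [pow_one]; exact hκ)⟩

/-- **Order 13: exactly `44` fixed rows and `44` fixed columns** (`48 + 48` orbits of length 13). -/
theorem hadamard668_fixedRows_13 {H : Matrix ι ι ℤ} (hH : IsHadamardMatrix H) (hι : Fintype.card ι = 668)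
    (π κ : Equiv.Perm ι) (d e : ι → ℤ) (haut : IsSignedAut H π κ d e)
    (hπ : π ^ 13 = 1) (hκ : κ ^ 13 = 1) (hne : π ≠ 1 ∨ κ ≠ 1) :
    (univ.filter fun i => π i = i).card = 44 ∧ (univ.filter fun j => κ j = j).card = 44 := by
  obtain ⟨hπ1, ⟨r, hr⟩, ⟨c, hc⟩⟩ :=
    fixed_row_col_gen hH hι 13 (by norm_num) (by norm_num) (by decide) π κ d e haut hπ hκ hne
  obtain ⟨hπr, hκc, h01, hrow, hpair, hcol, hcpair, hP, hB, hN, hρ, hτ, x₀, hx₀⟩ :=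
    transfer668 hH hι 13 π κ d e haut hπ hκ hπ1 hr hc
  have h := orbitStructure_13 (fun (x : {i // i ≠ r}) (y : {j // j ≠ c}) => inc H r c x.1 y.1) h01 hrow hpair hcol
    hcpair hP hB (π.subtypePerm hπr) (κ.subtypePerm hκc) hN hρ hτ x₀ hx₀
  constructor
  · rw [card_fixed_eq_succ π r hr hπr, h.2.1]
  · rw [card_fixed_eq_succ κ c hc hκc, h.1]

/-- **The fixed structure of every prime-order automorphism of H(668), `p ≥ 13` (summary).**  For a signed-permutation
automorphism `(π, κ, d, e)` of a Hadamard matrix of order `668` with `π^p = κ^p = 1`, `p ≥ 13` prime, `(π, κ) ≠ (1, 1)`: the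
number `f` of `π`-fixed rows equals the number of `κ`-fixed columns and
`(p, f) ∈ {(13,44), (23,1), (23,24), (37,2), (41,12), (83,4), (167,0)}`. -/
theorem hadamard668_signedAut_fixedRows {H : Matrix ι ι ℤ} (hH : IsHadamardMatrix H) (hι : Fintype.card ι = 668)
    (p : ℕ) (hp : p.Prime) (hp13 : 13 ≤ p) (π κ : Equiv.Perm ι) (d e : ι → ℤ) (haut : IsSignedAut H π κ d e)
    (hπ : π ^ p = 1) (hκ : κ ^ p = 1) (hne : π ≠ 1 ∨ κ ≠ 1) :
    (univ.filter fun i => π i = i).card = (univ.filter fun j => κ j = j).card ∧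
    ((p = 13 ∧ (univ.filter fun i => π i = i).card = 44) ∨
     (p = 23 ∧ ((univ.filter fun i => π i = i).card = 1 ∨ (univ.filter fun i => π i = i).card = 24)) ∨
     (p = 37 ∧ (univ.filter fun i => π i = i).card = 2) ∨
     (p = 41 ∧ (univ.filter fun i => π i = i).card = 12) ∨
     (p = 83 ∧ (univ.filter fun i => π i = i).card = 4) ∨
     (p = 167 ∧ (univ.filter fun i => π i = i).card = 0)) := by
  have hmem := hadamard668_signedAut_prime_mem' hH hι p hp π κ d e haut hπ hκ hne
  simp only [Finset.mem_insert, Finset.mem_singleton] at hmem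
  rcases hmem with h | h | h | h | h | h | h | h | h | h | h
  · omega
  · omega
  · omega
  · omega
  · omega
  · subst h
    have h13 := hadamard668_fixedRows_13 hH hι π κ d e haut hπ hκ hne
    exact ⟨by rw [h13.1, h13.2], Or.inl ⟨rfl, h13.1⟩⟩
  · subst h
    have h23 := hadamard668_fixedRows_23 hH hι π κ d e haut hπ hκ hne
    rcases h23 with ⟨h1, h2⟩ | ⟨h1, h2⟩
    · exact ⟨by rw [h1, h2], Or.inr (Or.inl ⟨rfl, Or.inl h1⟩)⟩
    · exact ⟨by rw [h1, h2], Or.inr (Or.inl ⟨rfl, Or.inr h1⟩)⟩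
  · subst h
    have h37 := hadamard668_fixedRows_37 hH hι π κ d e haut hπ hκ hne
    exact ⟨by rw [h37.1, h37.2], Or.inr (Or.inr (Or.inl ⟨rfl, h37.1⟩))⟩
  · subst h
    have h41 := hadamard668_fixedRows_41 hH hι π κ d e haut hπ hκ hne
    exact ⟨by rw [h41.1, h41.2], Or.inr (Or.inr (Or.inr (Or.inl ⟨rfl, h41.1⟩)))⟩
  · subst h
    have h83 := hadamard668_fixedRows_83 hH hι π κ d e haut hπ hκ hne
    exact ⟨by rw [h83.1, h83.2], Or.inr (Or.inr (Or.inr (Or.inr (Or.inl ⟨rfl, h83.1⟩))))⟩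
  · subst h
    have h167 := hadamard668_fixedRows_167 hH hι π κ d e haut hπ hκ hne
    exact ⟨by rw [h167.1, h167.2.1], Or.inr (Or.inr (Or.inr (Or.inr (Or.inr ⟨rfl, h167.1⟩))))⟩

end Summit.Ventures.DiscreteObjects.Hadamard
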